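import Literature.Computation.Certificates.KeyedGramStream

/-!
# Gram entry streams, II: semantics of the stream and of the side / pair passes

Companion of `KeyedGramStream` (definitions) in the «K-STREAM» kernel lane. Proved here:
the stream value splits into a Gram part `gsum` and a table part `tsum` (`eval_termsOf`); windows
concatenate (`entries_append`, `terms_append`, `gsum_append`); the side pass establishes its
per-entry conditions at every global position (`sideList_spec`, `SideOK`, `sideAll_of_sideOK`); the
pair pass establishes that every pair `i ≤ j < s` points below `P` at an entry recorded as `(i, j)`
(`pairPass_spec`); together they make position ↦ pair a bijection onto the pairs, so the Gram part
is the pair-indexed sum `Σ_{i≤j} mult(i,j)·(L·Q_ij)·x^{key i + key j}` (`gsum_eq_sum_pairs`, by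
`Finset.sum_image` / `Finset.sum_subset` — no counting argument).
[cite: BlekhermanParriloThomas2012, §3.1.4 eq. (3.12), p. 64 and Thm 3.39, p. 65]

WHAT THIS FILE IS NOT: no positivity statement yet (that is `KeyedGramStreamSound`, with the twin);
nothing here is evaluated by the kernel except in tests.
-/

namespace Literature.Computation.Certificates

namespace SOS

namespace Keyed

open PSD

/-! ### Semantics of the stream: plumbing -/

section Plumbing

/-- `entries` distributes over concatenation of chunk lists (windows of one stream).
[cite: BlekhermanParriloThomas2012, §3.1.4 eq. (3.12), p. 64] -/
theorem entries_append (c : GramCtx) : ∀ A B : List (ℕ × ℕ), entries c (A ++ B) = entries c A ++ entries c B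
  | [], B => rfl
  | (cnt, e) :: A, B => by rw [List.cons_append, entries, entries, entries_append c A B, List.append_assoc]

/-- `termsOf` distributes over concatenation. [cite: BlekhermanParriloThomas2012, §3.1.4 eq. (3.12), p. 64] -/
theorem termsOf_append (c : GramCtx) (tab : ℕ → ℕ × Bool × ℕ) :
    ∀ A B : List Entry, termsOf c tab (A ++ B) = termsOf c tab A ++ termsOf c tab B
  | [], B => rfl
  | en :: A, B => by rw [List.cons_append, termsOf, termsOf, termsOf_append c tab A B, List.cons_append]

/-- `STerms.toZ` distributes over concatenation. [cite: BlekhermanParriloThomas2012, §3.1.4 eq. (3.12), p. 64] -/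
theorem toZ_append : ∀ A B : STerms, STerms.toZ (A ++ B) = STerms.toZ A ++ STerms.toZ B
  | [], B => rfl
  | (k, sg, m) :: A, B => by rw [List.cons_append, STerms.toZ_cons, STerms.toZ_cons, toZ_append A B, List.cons_append]

/-- The terms of concatenated windows are the concatenated terms.
[cite: BlekhermanParriloThomas2012, §3.1.4 eq. (3.12), p. 64] -/
theorem terms_append (c : GramCtx) (tab : ℕ → ℕ × Bool × ℕ) (A B : List (ℕ × ℕ)) :
    terms c tab (A ++ B) = terms c tab A ++ terms c tab B := by
  rw [terms, entries_append, termsOf_append]; rfl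

variable {R : Type*} [Field R]

/-- Value of the GRAM part of one entry: `±mult(i,j)·mag · x^{key i + key j}`; table entries `0`.
[cite: BlekhermanParriloThomas2012, §3.1.4 eq. (3.12), p. 64] -/
def gval (x : ℕ → R) (b n : ℕ) (c : GramCtx) : Entry → R
  | Entry.gram i j sg mag => ((sval sg (mult i j * mag) : ℤ) : R) * monoEval x b n 0 (c.key i + c.key j)
  | Entry.tab _ => 0

/-- Value of the TABLE part of one entry (through `tab`); Gram entries `0`.
[cite: BlekhermanParriloThomas2012, §3.1.4 eq. (3.12), p. 64] -/
def tval (x : ℕ → R) (b n : ℕ) (tab : ℕ → ℕ × Bool × ℕ) : Entry → R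
  | Entry.gram _ _ _ _ => 0
  | Entry.tab id => ((sval (tab id).2.1 (tab id).2.2 : ℤ) : R) * monoEval x b n 0 (tab id).1

/-- Sum of the Gram parts of a list of entries. [cite: BlekhermanParriloThomas2012, §3.1.4 eq. (3.12), p. 64] -/
def gsum (x : ℕ → R) (b n : ℕ) (c : GramCtx) : List Entry → R
  | [] => 0
  | en :: L => gval x b n c en + gsum x b n c L

/-- Sum of the table parts of a list of entries. [cite: BlekhermanParriloThomas2012, §3.1.4 eq. (3.12), p. 64] -/
def tsum (x : ℕ → R) (b n : ℕ) (tab : ℕ → ℕ × Bool × ℕ) : List Entry → R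
  | [] => 0
  | en :: L => tval x b n tab en + tsum x b n tab L

/-- **Split of the stream value** into its Gram part and its table part.
[cite: BlekhermanParriloThomas2012, §3.1.4 eq. (3.12), p. 64] -/
theorem eval_termsOf (x : ℕ → R) (b n : ℕ) (c : GramCtx) (tab : ℕ → ℕ × Bool × ℕ) :
    ∀ L : List Entry, ZTerms.eval x b n (STerms.toZ (termsOf c tab L)) = gsum x b n c L + tsum x b n tab L
  | [] => by simp [termsOf, gsum, tsum]
  | Entry.gram i j sg mag :: L => by
    rw [termsOf, termOf, STerms.toZ_cons, ZTerms.eval_cons, eval_termsOf x b n c tab L, gsum, tsum, gval, tval]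
    ring
  | Entry.tab id :: L => by
    rw [termsOf, termOf]
    rcases h : tab id with ⟨k, sg, m⟩
    rw [STerms.toZ_cons, ZTerms.eval_cons, eval_termsOf x b n c tab L, gsum, tsum, gval, tval, h]
    ring

/-- A list of entries without table contributions (a pure Gram stream). [folklore] -/
def allGram : List Entry → Bool
  | [] => true
  | Entry.gram _ _ _ _ :: L => allGram L
  | Entry.tab _ :: _ => false

/-- A pure Gram stream has table part `0`. [cite: BlekhermanParriloThomas2012, §3.1.4 eq. (3.12), p. 64] -/
theorem tsum_eq_zero_of_allGram (x : ℕ → R) (b n : ℕ) (tab : ℕ → ℕ × Bool × ℕ) :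
    ∀ L : List Entry, allGram L = true → tsum x b n tab L = 0
  | [], _ => rfl
  | Entry.gram _ _ _ _ :: L, h => by
    rw [tsum, tval, tsum_eq_zero_of_allGram x b n tab L (by simpa [allGram] using h), add_zero]
  | Entry.tab _ :: _, h => by simp [allGram] at h

/-- `gsum` over concatenation. [cite: BlekhermanParriloThomas2012, §3.1.4 eq. (3.12), p. 64] -/
theorem gsum_append (x : ℕ → R) (b n : ℕ) (c : GramCtx) :
    ∀ A B : List Entry, gsum x b n c (A ++ B) = gsum x b n c A + gsum x b n c B
  | [], B => by simp [gsum]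
  | en :: A, B => by rw [List.cons_append, gsum, gsum, gsum_append x b n c A B, add_assoc]

/-- `gsum` as a sum over positions. [cite: BlekhermanParriloThomas2012, §3.1.4 eq. (3.12), p. 64] -/
theorem gsum_eq_sum_range (x : ℕ → R) (b n : ℕ) (c : GramCtx) :
    ∀ L : List Entry, gsum x b n c L = ∑ π ∈ Finset.range L.length, gval x b n c (L.getD π (Entry.tab 0))
  | [] => by simp [gsum]
  | en :: L => by
    rw [gsum, List.length_cons, Finset.sum_range_succ', gsum_eq_sum_range x b n c L, add_comm]
    simp

end Plumbing

/-! ### Semantics of the side pass and the pair pass -/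

section Passes

/-- What the side pass establishes at every position of the list it walked.
[cite: BlekhermanParriloThomas2012, §3.1.4 eq. (3.12), p. 64] -/
theorem sideList_spec (c : GramCtx) (d : SideCtx) :
    ∀ (π₀ : ℕ) (L : List Entry), sideList c d π₀ L = true →
      ∀ k < L.length, sideEntry c d (π₀ + k) (L.getD k (Entry.tab 0)) = true
  | π₀, [], _, k, hk => by simp at hk
  | π₀, en :: L, h, k, hk => by
    simp only [sideList, Bool.and_eq_true] at h
    cases k with
    | zero => simpa using h.1
    | succ k =>
      have hk' : k < L.length := by simpa using hk
      have := sideList_spec c d (π₀ + 1) L h.2 k hk'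
      simpa [Nat.add_assoc, Nat.add_comm 1 k] using this

/-- **Side conditions at all positions** of a (concatenated) entry list.
[cite: BlekhermanParriloThomas2012, §3.1.4 eq. (3.12), p. 64] -/
def SideAll (c : GramCtx) (d : SideCtx) (EL : List Entry) : Prop :=
  ∀ π < EL.length, sideEntry c d π (EL.getD π (Entry.tab 0)) = true

/-- **Window list of side passes**: `SideOK c d π [W₀, W₁, …]` says `sidePass c d π W₀ = true`,
`sidePass c d (π + |W₀|) W₁ = true`, … — one `decide +kernel` per window file, assembled by
`⟨h₀, h₁, …, trivial⟩`. [cite: BlekhermanParriloThomas2012, §3.1.4 eq. (3.12), p. 64] -/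
def SideOK (c : GramCtx) (d : SideCtx) : ℕ → List (List (ℕ × ℕ)) → Prop
  | _, [] => True
  | π, w :: W => sidePass c d π w = true ∧ SideOK c d (π + (entries c w).length) W

/-- Flatten a window list into one chunk list. [folklore] -/
def windowsChunks : List (List (ℕ × ℕ)) → List (ℕ × ℕ)
  | [] => []
  | w :: W => w ++ windowsChunks W

/-- The entries of all windows. [cite: BlekhermanParriloThomas2012, §3.1.4 eq. (3.12), p. 64] -/
theorem entries_windowsChunks (c : GramCtx) :
    ∀ W : List (List (ℕ × ℕ)), entries c (windowsChunks W) = (W.map (entries c)).flatten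
  | [] => rfl
  | w :: W => by rw [windowsChunks, entries_append, entries_windowsChunks c W, List.map_cons, List.flatten_cons]

/-- Shifted form of `SideAll` used in the window induction. [folklore] -/
private theorem sideAll_shift (c : GramCtx) (d : SideCtx) :
    ∀ (W : List (List (ℕ × ℕ))) (π₀ : ℕ), SideOK c d π₀ W →
      ∀ k < (entries c (windowsChunks W)).length,
        sideEntry c d (π₀ + k) ((entries c (windowsChunks W)).getD k (Entry.tab 0)) = true
  | [], π₀, _, k, hk => by simp [windowsChunks, entries] at hk
  | w :: W, π₀, h, k, hk => by
    obtain ⟨h1, h2⟩ := h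
    rw [windowsChunks, entries_append] at hk ⊢
    by_cases hlt : k < (entries c w).length
    · rw [List.getD_append _ _ _ _ hlt]
      exact sideList_spec c d π₀ _ h1 k hlt
    · rw [not_lt] at hlt
      obtain ⟨k', rfl⟩ := Nat.exists_eq_add_of_le hlt
      rw [List.length_append] at hk
      rw [List.getD_append_right _ _ _ _ (Nat.le_add_right _ _), Nat.add_sub_cancel_left, ← Nat.add_assoc]
      exact sideAll_shift c d W (π₀ + (entries c w).length) h2 k' (by omega)

/-- **Windows ⇒ all positions**: the per-window side passes give the side conditions at every
global position of the whole stream. [cite: BlekhermanParriloThomas2012, §3.1.4 eq. (3.12), p. 64] -/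
theorem sideAll_of_sideOK (c : GramCtx) (d : SideCtx) {W : List (List (ℕ × ℕ))} (h : SideOK c d 0 W) :
    SideAll c d (entries c (windowsChunks W)) := fun π hπ => by
  simpa using sideAll_shift c d W 0 h π hπ

/-- What the pair pass establishes for the pairs of one row from column `j` on.
[cite: BlekhermanParriloThomas2012, §3.1.4 eq. (3.12), p. 64] -/
theorem pairRow_spec (c : GramCtx) (d : SideCtx) (P i : ℕ) :
    ∀ (k j : ℕ), pairRow c d P i k j = true → ∀ j', j ≤ j' → j' < j + k →
      d.posAt i j' < P ∧ d.iAt c.wi (d.posAt i j') = i ∧ d.jAt c.wi (d.posAt i j') = j'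
  | 0, j, _, j', h1, h2 => by omega
  | k + 1, j, h, j', h1, h2 => by
    simp only [pairRow, Bool.and_eq_true, decide_eq_true_eq, beq_iff_eq] at h
    obtain ⟨⟨⟨hP, hi⟩, hj⟩, hrest⟩ := h
    by_cases hjj : j' = j
    · subst hjj; exact ⟨hP, hi, hj⟩
    · exact pairRow_spec c d P i k (j + 1) hrest j' (by omega) (by omega)

/-- What the pair pass establishes for rows `i, i+1, …`. [cite: BlekhermanParriloThomas2012, §3.1.4 eq. (3.12), p. 64] -/
theorem pairRows_spec (c : GramCtx) (d : SideCtx) (P : ℕ) :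
    ∀ (k i : ℕ), pairRows c d P k i = true → ∀ i' j', i ≤ i' → i' < i + k → i' ≤ j' → j' < c.s →
      d.posAt i' j' < P ∧ d.iAt c.wi (d.posAt i' j') = i' ∧ d.jAt c.wi (d.posAt i' j') = j'
  | 0, i, _, i', j', h1, h2, _, _ => by omega
  | k + 1, i, h, i', j', h1, h2, h3, h4 => by
    simp only [pairRows, Bool.and_eq_true] at h
    by_cases hii : i' = i
    · subst hii
      exact pairRow_spec c d P i' (c.s - i') i' h.1 j' h3 (by omega)
    · exact pairRows_spec c d P k (i + 1) h.2 i' j' (by omega) (by omega) h3 h4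

/-- **Pair pass ⇒ every pair `i ≤ j < s` points below `P` at an entry recorded as `(i, j)`.**
[cite: BlekhermanParriloThomas2012, §3.1.4 eq. (3.12), p. 64] -/
theorem pairPass_spec {c : GramCtx} {d : SideCtx} {P : ℕ} (h : pairPass c d P = true) {i j : ℕ}
    (hij : i ≤ j) (hj : j < c.s) :
    d.posAt i j < P ∧ d.iAt c.wi (d.posAt i j) = i ∧ d.jAt c.wi (d.posAt i j) = j :=
  pairRows_spec c d P c.s 0 h i j (Nat.zero_le _) (by omega) hij hj

end Passes

/-! ### The stream as a symmetric matrix; the Gram sum as a quadratic form -/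

section Gram

variable {R : Type*} [Field R]

/-- Entry at global position `π` of an entry list (`Entry.tab 0` past the end). [folklore] -/
def entryAt (EL : List Entry) (π : ℕ) : Entry := EL.getD π (Entry.tab 0)

/-- Integer value carried at position `π` (`0` at table entries). [folklore] -/
def valAt (EL : List Entry) (π : ℕ) : ℤ :=
  match entryAt EL π with
  | Entry.gram _ _ sg mag => sval sg mag
  | Entry.tab _ => 0

/-- **The symmetric integer matrix of the stream** (`L · Q`): entry `(i, j)` is the value at the
recorded position of the pair `(min, max)`. Never evaluated by the kernel — a specification.
[cite: BlekhermanParriloThomas2012, §3.1.4 eq. (3.12), p. 64] -/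
def Qz (c : GramCtx) (d : SideCtx) (EL : List Entry) : Matrix (Fin c.s) (Fin c.s) ℤ :=
  fun i j => if i.val ≤ j.val then valAt EL (d.posAt i.val j.val) else valAt EL (d.posAt j.val i.val)

/-- The matrix of the stream is symmetric. [cite: BlekhermanParriloThomas2012, §3.1.4 eq. (3.12), p. 64] -/
theorem Qz_symm (c : GramCtx) (d : SideCtx) (EL : List Entry) (i j : Fin c.s) :
    Qz c d EL i j = Qz c d EL j i := by
  unfold Qz
  by_cases h : i.val ≤ j.val
  · by_cases h' : j.val ≤ i.val
    · have : i = j := Fin.ext (le_antisymm h h')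
      subst this; rfl
    · rw [if_pos h, if_neg h']
  · have h' : j.val ≤ i.val := by omega
    rw [if_neg h, if_pos h']

/-- `sval` is multiplicative in the magnitude. [folklore] -/
private theorem sval_mul (sg : Bool) (t m : ℕ) : sval sg (t * m) = (t : ℤ) * sval sg m := by
  unfold sval; split <;> push_cast <;> ring

/-- **The Gram entry found at the position of a pair.** Under the side conditions (all positions)
and the pair pass, position `posAt i j` (`i ≤ j < s`) holds a Gram entry recorded as `(i, j)`.
[cite: BlekhermanParriloThomas2012, §3.1.4 eq. (3.12), p. 64] -/
theorem entryAt_posAt {c : GramCtx} {d : SideCtx} {EL : List Entry} (hside : SideAll c d EL)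
    (hpair : pairPass c d EL.length = true) {i j : ℕ} (hij : i ≤ j) (hj : j < c.s) :
    ∃ sg mag, entryAt EL (d.posAt i j) = Entry.gram i j sg mag ∧
      sideEntry c d (d.posAt i j) (Entry.gram i j sg mag) = true := by
  obtain ⟨hP, hi, hj'⟩ := pairPass_spec hpair hij hj
  have hs := hside _ hP
  unfold entryAt
  cases hE : EL.getD (d.posAt i j) (Entry.tab 0) with
  | tab id =>
    rw [hE] at hs
    simp only [sideEntry, decide_eq_true_eq] at hs
    omega
  | gram i' j' sg mag =>
    rw [hE] at hs
    have hs' := hs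
    simp only [sideEntry, Bool.and_eq_true, decide_eq_true_eq, beq_iff_eq] at hs'
    obtain ⟨⟨⟨⟨⟨⟨_, _⟩, _⟩, hi2⟩, hj2⟩, _⟩, _⟩ := hs'
    have e1 : i' = i := by rw [← hi2, hi]
    have e2 : j' = j := by rw [← hj2, hj']
    subst e1; subst e2
    exact ⟨sg, mag, rfl, hs⟩

/-- The set of index pairs `i ≤ j < s`. [folklore] -/
def upperPairs (s : ℕ) : Finset (ℕ × ℕ) :=
  (Finset.range s ×ˢ Finset.range s).filter fun q => q.1 ≤ q.2

/-- Membership in `upperPairs`. [folklore] -/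
private theorem mem_upperPairs {s : ℕ} {q : ℕ × ℕ} : q ∈ upperPairs s ↔ q.1 ≤ q.2 ∧ q.2 < s := by
  unfold upperPairs
  simp only [Finset.mem_filter, Finset.mem_product, Finset.mem_range]
  constructor
  · rintro ⟨⟨_, h2⟩, h3⟩; exact ⟨h3, h2⟩
  · rintro ⟨h1, h2⟩; exact ⟨⟨by omega, h2⟩, h1⟩

/-- **Reindexing the Gram sum by pairs**: under the side conditions and the pair pass, the stream's
Gram part is the sum over the pairs `i ≤ j < s` of `mult(i,j) · Q_{ij} · x^{key i + key j}` — the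
map position ↦ pair is a bijection onto the pairs (two-sided inverse given by the position and
index tables). [cite: BlekhermanParriloThomas2012, §3.1.4 eq. (3.12), p. 64] -/
theorem gsum_eq_sum_pairs (x : ℕ → R) (b n : ℕ) {c : GramCtx} {d : SideCtx} {EL : List Entry}
    (hside : SideAll c d EL) (hpair : pairPass c d EL.length = true) :
    gsum x b n c EL = ∑ q ∈ upperPairs c.s,
      ((mult q.1 q.2 : ℤ) * valAt EL (d.posAt q.1 q.2) : ℤ) * monoEval x b n 0 (c.key q.1 + c.key q.2) := by
  classical
  rw [gsum_eq_sum_range]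
  set P := EL.length
  let pos' : ℕ × ℕ → ℕ := fun q => d.posAt q.1 q.2
  -- injectivity of the position table on the pairs
  have hinj : Set.InjOn pos' ↑(upperPairs c.s) := by
    intro q hq q' hq' h
    rw [Finset.mem_coe, mem_upperPairs] at hq hq'
    obtain ⟨_, hi, hj⟩ := pairPass_spec hpair hq.1 hq.2
    obtain ⟨_, hi', hj'⟩ := pairPass_spec hpair hq'.1 hq'.2
    have h1 : q.1 = q'.1 := by rw [← hi, ← hi']; exact congrArg _ h
    have h2 : q.2 = q'.2 := by rw [← hj, ← hj']; exact congrArg _ h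
    exact Prod.ext h1 h2
  -- the image of the pairs carries the whole sum
  have himg : (upperPairs c.s).image pos' ⊆ Finset.range P := by
    intro π hπ
    rw [Finset.mem_image] at hπ
    obtain ⟨q, hq, rfl⟩ := hπ
    rw [mem_upperPairs] at hq
    exact Finset.mem_range.mpr (pairPass_spec hpair hq.1 hq.2).1
  have hzero : ∀ π ∈ Finset.range P, π ∉ (upperPairs c.s).image pos' →
      gval x b n c (EL.getD π (Entry.tab 0)) = 0 := by
    intro π hπ hnot
    have hs := hside π (Finset.mem_range.mp hπ)
    cases hE : EL.getD π (Entry.tab 0) with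
    | tab id => rfl
    | gram i j sg mag =>
      exfalso
      rw [hE] at hs
      simp only [sideEntry, Bool.and_eq_true, decide_eq_true_eq, beq_iff_eq] at hs
      obtain ⟨⟨⟨⟨⟨⟨hij, hjs⟩, hpos⟩, _⟩, _⟩, _⟩, _⟩ := hs
      exact hnot (Finset.mem_image.mpr ⟨(i, j), mem_upperPairs.mpr ⟨hij, hjs⟩, hpos⟩)
  rw [← Finset.sum_subset himg hzero, Finset.sum_image hinj]
  refine Finset.sum_congr rfl fun q hq => ?_
  rw [mem_upperPairs] at hq
  obtain ⟨sg, mag, hE, _⟩ := entryAt_posAt hside hpair hq.1 hq.2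
  unfold entryAt at hE
  show gval x b n c (EL.getD (d.posAt q.1 q.2) (Entry.tab 0)) = _
  rw [hE, gval, valAt, entryAt, hE, sval_mul]

end Gram

end Keyed

end SOS

end Literature.Computation.Certificates

/-! ### Splitting the pair pass into row ranges (APPEND 2026-08-27; per-file budget insurance)

`pairPass c d P = pairRows c d P c.s 0` is one decide; when that exceeds a client's per-file budget the
pass is filed as consecutive ROW RANGES `pairRows c d P k₁ 0`, `pairRows c d P k₂ k₁`, … (one decide
each) and reassembled by rewriting with `pairRows_add` — no new soundness statement is needed. -/

namespace Literature.Computation.Certificates.SOS.Keyed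

/-- `pairRows` over `k₁ + k₂` rows from row `i` is the conjunction of the ranges `[i, i+k₁)` and
`[i+k₁, i+k₁+k₂)`. [cite: BlekhermanParriloThomas2012, §3.1.4 eq. (3.12), p. 64] -/
theorem pairRows_add (c : GramCtx) (d : SideCtx) (P : ℕ) :
    ∀ (k₁ k₂ i : ℕ), pairRows c d P (k₁ + k₂) i = (pairRows c d P k₁ i && pairRows c d P k₂ (i + k₁))
  | 0, k₂, i => by simp [pairRows]
  | k₁ + 1, k₂, i => by
    rw [Nat.add_right_comm, pairRows, pairRows, pairRows_add c d P k₁ k₂ (i + 1), Bool.and_assoc,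
      Nat.add_assoc, Nat.add_comm 1 k₁]

/-- Usage template (kernel): the `3 × 3` test context of `KeyedGramStreamWindows` is not imported
here, so a generic instance: a pass over `3 = 2 + 1` rows from two range facts. [folklore] -/
example (c : GramCtx) (d : SideCtx) (P : ℕ) (h₁ : pairRows c d P 2 0 = true)
    (h₂ : pairRows c d P 1 2 = true) (hs : c.s = 3) : pairPass c d P = true := by
  rw [pairPass, hs, show (3 : ℕ) = 2 + 1 from rfl, pairRows_add, h₁]
  simpa using h₂

end Literature.Computation.Certificates.SOS.Keyed
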